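import Literature.NumberTheory.Transcendental.DeRhamTheoremProofs
import Literature.Geometry.Manifold.CechSmoothSingularDeRhamZigzag
import Literature.AlgebraicTopology.SingularHomology.CupProduct
import HarnessLib

/-!
# Integration classes on smooth small cochains

The integration isomorphism family of de Rham's theorem
(`Literature.NumberTheory.Transcendental.integrationDeRhamIsoFamily`: `[α] ↦ [σ ↦ ∫_σ α]`, the
composite `H^k_dR(M) ≅ Hᵏ(Ω•(univ)) ≅ Hᵏ(M; ℝ)` of `deRhamIsoLocal` and `deRhamComparisonIso`)
is related here to the Čech–smooth-singular double complex of an open family `𝔘` of `M`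
(`Literature.Geometry.Manifold.CechSmoothSingular`): **if the integration class of a closed form
`η` is the class of a singular cocycle `ζ`, then on the smooth `𝔘`-small chains the functional
`∑ a_σ σ ↦ ∑ a_σ ζ(σ)` and the integration cochain `∫η` differ by a coboundary**
(`exists_singSmall_sub_intSmall_eq_dA`). This is the unpacking of the defining relation
`comparison ≫ H(singIso) ≫ H(toSmoothAll) = H(Ψ)` of `deRhamComparisonIso`
(`deRhamComparisonIso_hom_comp`) followed by restriction of cochains from the smooth chains of
`univ` to the smooth `𝔘`-small chains; it is the entry point of the Čech integrality step of
Lefschetz's theorem on `(1,1)`-classes (an INTEGRAL class has such a `ζ` with integer values).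

* `restrictToSmallₗ U k` — restriction `Hom(Δ^{sm}(univ), ℝ) → Hom(Δ^{sm,𝔘}, ℝ)`; commutes with the
  coboundaries (`restrictToSmall_d`), sends `Ψ(η)` to `∫η` (`restrictToSmall_deRhamMap`);
* `singSmall U k φ` — a singular cochain `φ` (a function on simplices) as a smooth small cochain;
  its values (`singSmall_apply_single`), a cocycle when `φ` is (`singSmall_mem_cocycles`);
* `exists_singSmall_sub_intSmall_eq_dA` — the comparison.

No named facts; everything is proved.

## References

* G. E. Bredon, *Topology and Geometry* (1993), Thm. V.9.5. [Bredon1993]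
* A. Weil, *Sur les théorèmes de de Rham*, Comment. Math. Helv. 26 (1952), §3.
-/

noncomputable section

-- see "Implementation notes" in `…SingularHomology.SingularChainsConcrete`
set_option backward.isDefEq.respectTransparency false

open scoped Manifold ContDiff Topology
open CategoryTheory Limits Set Literature.AlgebraicTopology.SingularHomology Literature.Geometry.Kaehler
  Literature.Algebra.Homology

universe u

namespace Literature.Geometry.Manifold

variable {E : Type u} [NormedAddCommGroup E] [NormedSpace ℝ E]
  {H : Type u} [TopologicalSpace H] {I : ModelWithCorners ℝ E H}
  {M : Type u} [TopologicalSpace M] [ChartedSpace H M]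
  {ι : Type*} (U : ι → Set M)

/-! ### Restriction to the smooth small chains -/

omit [ChartedSpace H M] in
/-- The smooth `𝔘`-small chains are smooth chains of `univ`. [folklore] -/
theorem smoothSmallSub_le_univ [ChartedSpace H M] : smoothSmallSub I ℝ U ≤ smoothChainsInSub I ℝ ℝ M univ := by
  rw [smoothChainsInSub_univ]
  exact inf_le_left

/-- **Restriction of cochains of `Hom(Δ^{sm}(univ), ℝ)` to the smooth `𝔘`-small chains** (and
unwrapping of the `ULift` coefficients). [cite: Bredon1993, §V.9] -/
def restrictToSmallₗ (k : ℕ) :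
    ((smoothSubsetCochains I ℝ realCoeff.{u} M univ).X k) →ₗ[ℝ] SmoothSmallCochain I ℝ ℝ U k where
  toFun ψ := ULift.moduleEquiv.toLinearMap ∘ₗ
    ModuleCat.Hom.hom (ψ : (smoothChainsInSub I ℝ ℝ M univ).toComplex.X k ⟶ realCoeff) ∘ₗ
      ModuleCat.Hom.hom ((Subcomplex.incl (smoothSmallSub_le_univ (I := I) U)).f k)
  map_add' _ _ := rfl
  map_smul' _ _ := rfl

/-- Values of the restriction. [folklore] -/
theorem restrictToSmallₗ_apply (k : ℕ) (ψ : (smoothSubsetCochains I ℝ realCoeff.{u} M univ).X k)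
    (c : (smoothSmallSub I ℝ U).toComplex.X k) :
    restrictToSmallₗ U k ψ c =
      cochainVal ψ ((Subcomplex.incl (smoothSmallSub_le_univ (I := I) U)).f k c) :=
  rfl

/-- **Restriction commutes with the coboundaries.** [folklore] -/
theorem restrictToSmall_d (n : ℕ) (w : (smoothSubsetCochains I ℝ realCoeff.{u} M univ).X n) :
    restrictToSmallₗ U (n + 1) ((smoothSubsetCochains I ℝ realCoeff.{u} M univ).d n (n + 1) w) =
      (cechSmoothSingularRow I ℝ ℝ U).dA n (restrictToSmallₗ U n w) := by
  refine LinearMap.ext fun c ↦ ?_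
  have e : (smoothChainsInSub I ℝ ℝ M univ).toComplex.d (n + 1) n
      ((Subcomplex.incl (smoothSmallSub_le_univ (I := I) U)).f (n + 1) c) =
      (Subcomplex.incl (smoothSmallSub_le_univ (I := I) U)).f n ((smoothSmallSub I ℝ U).toComplex.d (n + 1) n c) :=
    Subtype.ext (by rw [toComplex_d_val, Subcomplex.incl_f_apply_val, Subcomplex.incl_f_apply_val, toComplex_d_val])
  rw [restrictToSmallₗ_apply, dualObj_d_apply]
  change cochainVal w ((smoothChainsInSub I ℝ ℝ M univ).toComplex.d (n + 1) n
    ((Subcomplex.incl (smoothSmallSub_le_univ (I := I) U)).f (n + 1) c)) =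
    restrictToSmallₗ U n w ((smoothSmallSub I ℝ U).toComplex.d (n + 1) n c)
  rw [e, restrictToSmallₗ_apply]

variable [IsManifold I ∞ M]

/-- **Restriction sends `Ψ(η)` to the integration cochain `∫η`.** [folklore] -/
theorem restrictToSmall_deRhamMap (k : ℕ) (η : (localDeRhamComplex I ℝ (isOpen_univ : IsOpen (univ : Set M))).X k) :
    restrictToSmallₗ U k ((deRhamMap I isOpen_univ).f k η) = intSmallCochain U k (η.1 : MForm I M ℝ k) :=
  LinearMap.ext fun c ↦ by
    rw [restrictToSmallₗ_apply, deRhamMap_cochainVal, Subcomplex.incl_f_apply_val]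
    rfl

/-! ### Singular cochains as smooth small cochains -/

omit [IsManifold I ∞ M] in
variable (I) in
/-- **A singular cochain `φ` (a function on simplices) as a smooth `𝔘`-small cochain**:
`∑ a_σ σ ↦ ∑ a_σ φ(σ)` (through `singIso` and `toSmoothAll` of `DeRhamComparison`).
[cite: HatcherAT2002, §3.1 p. 197] -/
def singSmall (k : ℕ) (φ : (singularCochainComplex ℝ ℝ M).X k) : SmoothSmallCochain I ℝ ℝ U k :=
  restrictToSmallₗ U k ((toSmoothAll I M).f k ((singIso M).hom.f k φ))

omit [IsManifold I ∞ M] in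
/-- **Values**: on an elementary smooth small chain `σ`, `singSmall φ` takes the value `φ(σ)`. [folklore] -/
theorem singSmall_apply_single (k : ℕ) (φ : (singularCochainComplex ℝ ℝ M).X k) {σ : SingularSimplex M k}
    (hσ : Finsupp.single σ (1 : ℝ) ∈ smoothSmallSub I ℝ U k) :
    singSmall I U k φ ⟨Finsupp.single σ 1, hσ⟩ = φ σ := by
  change (ModuleCat.Hom.hom ((singIso M).hom.f k φ : (csingularChainComplex ℝ ℝ M).X k ⟶ realCoeff)
    (Finsupp.single σ 1)).down = φ σ
  rw [singIso_hom_f_apply_single]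
  exact one_mul _

omit [IsManifold I ∞ M] in
/-- **`singSmall φ` is a cocycle of the smooth small cochains when `φ` is a singular cocycle.**
[folklore] -/
theorem singSmall_mem_cocycles (k : ℕ) (φ : (singularCochainComplex ℝ ℝ M).X k)
    (hφ : (singularCochainComplex ℝ ℝ M).d k (k + 1) φ = 0) :
    singSmall I U k φ ∈ NatCochain.cocycles (cechSmoothSingularRow I ℝ ℝ U).dA k := by
  rw [NatCochain.mem_cocycles_iff, singSmall, ← restrictToSmall_d]
  have h : (smoothSubsetCochains I ℝ realCoeff.{u} M univ).d k (k + 1)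
      ((toSmoothAll I M).f k ((singIso M).hom.f k φ)) =
      (toSmoothAll I M).f (k + 1) ((singIso M).hom.f (k + 1) ((singularCochainComplex ℝ ℝ M).d k (k + 1) φ)) := by
    have hc := ((singIso M).hom ≫ toSmoothAll I M).comm k (k + 1)
    rw [HomologicalComplex.comp_f, HomologicalComplex.comp_f, Category.assoc] at hc
    rw [← ModuleCat.comp_apply, ← ModuleCat.comp_apply, hc, ModuleCat.comp_apply, ModuleCat.comp_apply]
  rw [h, hφ, map_zero, map_zero, map_zero]

/-! ### The class of a cocycle is a `homologyCls` -/

omit [IsManifold I ∞ M] [ChartedSpace H M] in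
/-- The class `π u` of a singular cocycle is the `homologyCls` of its cochain. [folklore] -/
theorem π_eq_homologyCls {n : ℕ} (u : singularCochainComplex.cocycles ℝ ℝ M n)
    (hu : (singularCochainComplex ℝ ℝ M).d n ((ComplexShape.up ℕ).next n)
      (singularCochainComplex.iCocycles ℝ ℝ M n u) = 0) :
    singularCohomology.π ℝ ℝ M n u = homologyCls (singularCochainComplex.iCocycles ℝ ℝ M n u) hu := by
  have key : homologyCls (singularCochainComplex.iCocycles ℝ ℝ M n u) hu =
      (singularCochainComplex ℝ ℝ M).homologyπ n ((singularCochainComplex ℝ ℝ M).cyclesMk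
        (singularCochainComplex.iCocycles ℝ ℝ M n u) (n + 1) (by simp)
          (singularCochainComplex.d_iCocycles (n + 1) u)) := by
    unfold homologyCls scHomologyCls
    congr 1
    apply (ModuleCat.mono_iff_injective (((singularCochainComplex ℝ ℝ M).sc n).iCycles)).mp inferInstance
    rw [ShortComplex.moduleCatCyclesIso_inv_iCycles_apply]
    exact (((singularCochainComplex ℝ ℝ M).sc n).i_cyclesMk _ hu).symm
  rw [key]
  change _ = singularCohomology.π ℝ ℝ M n _
  congr 1
  exact singularCochainComplex.cocycles_ext (singularCochainComplex.iCocycles_mk _ _).symm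

/-! ### The comparison -/

/-- **Integration classes on smooth small cochains.** If the integration class of the closed
`(n+1)`-form `η` (de Rham's theorem by integration, `integrationDeRhamIsoFamily`) is the class of
the singular cocycle `ζ`, then on the smooth `𝔘`-small chains of any family `𝔘` the cochain of
`ζ` and the integration cochain `∫η` differ by a coboundary: `singSmall ζ − ∫η = δW`.
[cite: Bredon1993, Thm. V.9.5] -/
theorem exists_singSmall_sub_intSmall_eq_dA {E : Type u} [NormedAddCommGroup E] [NormedSpace ℝ E]
    [FiniteDimensional ℝ E] {M : Type u} [TopologicalSpace M] [ChartedSpace E M] [IsManifold 𝓘(ℝ, E) ∞ M]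
    [T2Space M] [SigmaCompactSpace M] {n : ℕ} (η : closedSmoothForms 𝓘(ℝ, E) M ℝ (n + 1))
    (ζ : singularCochainComplex.cocycles ℝ ℝ M (n + 1))
    (h : Literature.NumberTheory.Transcendental.integrationDeRhamIsoFamily E M (n + 1) (deRhamCohomology.mk η) =
      singularCohomology.π ℝ ℝ M (n + 1) ζ)
    {ι : Type*} (U : ι → Set M) :
    ∃ W : SmoothSmallCochain 𝓘(ℝ, E) ℝ ℝ U n,
      singSmall 𝓘(ℝ, E) U (n + 1) (singularCochainComplex.iCocycles ℝ ℝ M (n + 1) ζ) -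
          intSmallCochain U (n + 1) (η : MForm 𝓘(ℝ, E) M ℝ (n + 1)) =
        (cechSmoothSingularRow 𝓘(ℝ, E) ℝ ℝ U).dA n W := by
  haveI : SecondCountableTopology M :=
    Literature.NumberTheory.Transcendental.secondCountableTopology_of_sigmaCompact E M
  haveI : LocallyCompactSpace M := Literature.NumberTheory.Transcendental.locallyCompactSpace_of_chartedSpace E M
  rw [Literature.NumberTheory.Transcendental.integrationDeRhamIsoFamily_apply, deRhamIsoLocal_mk,
    π_eq_homologyCls ζ (singularCochainComplex.d_iCocycles _ ζ)] at h
  have key := deRhamComparisonIso_hom_comp (I := 𝓘(ℝ, E)) (M := M) (n + 1)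
  -- test both sides against `H(singIso) ≫ H(toSmoothAll)`
  set F := HomologicalComplex.homologyMap (singIso M).hom (n + 1) ≫
    HomologicalComplex.homologyMap (toSmoothAll 𝓘(ℝ, E) M) (n + 1) with hF
  have hA : HomologicalComplex.homologyMap (deRhamMap 𝓘(ℝ, E) (isOpen_univ : IsOpen (univ : Set M))) (n + 1)
      (homologyCls (closedToUniv 𝓘(ℝ, E) M ℝ (n + 1) η) (d_closedToUniv η)) =
      F (homologyCls (singularCochainComplex.iCocycles ℝ ℝ M (n + 1) ζ) (singularCochainComplex.d_iCocycles _ ζ)) := by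
    rw [← key]
    exact congrArg F h
  have hB := homologyMap_homologyCls (deRhamMap 𝓘(ℝ, E) (isOpen_univ : IsOpen (univ : Set M)))
    (closedToUniv 𝓘(ℝ, E) M ℝ (n + 1) η) (d_closedToUniv η)
  have hC : F (homologyCls (singularCochainComplex.iCocycles ℝ ℝ M (n + 1) ζ) (singularCochainComplex.d_iCocycles _ ζ)) =
      HomologicalComplex.homologyMap (toSmoothAll 𝓘(ℝ, E) M) (n + 1)
        (HomologicalComplex.homologyMap (singIso M).hom (n + 1)
          (homologyCls (singularCochainComplex.iCocycles ℝ ℝ M (n + 1) ζ) (singularCochainComplex.d_iCocycles _ ζ))) :=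
    rfl
  have hD := homologyMap_homologyCls (singIso M).hom (singularCochainComplex.iCocycles ℝ ℝ M (n + 1) ζ)
    (singularCochainComplex.d_iCocycles _ ζ)
  have hE := homologyMap_homologyCls (toSmoothAll 𝓘(ℝ, E) M)
    ((singIso M).hom.f (n + 1) (singularCochainComplex.iCocycles ℝ ℝ M (n + 1) ζ))
    (d_hom_f_eq_zero (singIso M).hom _ (singularCochainComplex.d_iCocycles _ ζ))
  have h3 := hB.symm.trans ((hA.trans hC).trans
    ((congrArg (HomologicalComplex.homologyMap (toSmoothAll 𝓘(ℝ, E) M) (n + 1)) hD).trans hE))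
  obtain ⟨w, hw⟩ := (exists_d_prev_eq_iff ((ComplexShape.down ℕ).symm.prev_eq' (rfl : n + 1 = n + 1)) _).1
    ((homologyCls_eq_homologyCls_iff _ _ _ _).1 h3)
  refine ⟨-restrictToSmallₗ U n w, ?_⟩
  rw [map_neg, ← restrictToSmall_d, hw, map_sub, restrictToSmall_deRhamMap, singSmall, neg_sub]
  rfl

end Literature.Geometry.Manifold

end
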